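import Mathlib
import HarnessLib
import Literature.Analysis.FluidPDE.SereginSverakLocalHolderBoundHolds
import Literature.Analysis.FluidPDE.SereginSverakBlowupSelection
import Literature.Analysis.FluidPDE.LocalTypeIBlowup.Normalization

/-!
# Blow-up at a local Type I singular point (Albritton–Barker 2019, Thm. 1.1, forward direction;
# Seregin–Šverák 2009, Thm. 2.8), file 9:
# the blow-up sequence keeps a uniform amount of `L³` mass near the vertex

Analysis/FluidPDE proof file (theorems only: no definition, no named fact, no `sorry`).  PORT NOTE: this
module is the Literature twin of the Summits-side file
`Summits/NavierStokesRegularity/NavierStokesRegularity/Theorems/HardyPointSinkABForwardHardyNontrivial.lean` (prover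
seats of route HardyPointSink, landed 2026-08-16, kernel-checked), carried over verbatim up to the namespace
(`Literature.Analysis.FluidPDE.LocalTypeIBlowup`, topic-aligned) and the provenance tags, so that the Literature named
facts `Literature.Analysis.FluidPDE.AlbrittonBarkerForward` (`LocalTypeICharacterization.lean`) and
`Literature.Analysis.FluidPDE.AlbrittonBarkerTypeICharacterization` (`LocalTypeI.lean`) are discharged INSIDE
`Literature/` (`AlbrittonBarkerForwardHolds.lean`), where `LocalTypeICharacterizationHolds.lean` asks for them; the
Summits copies are the dedup candidates of record (librarian pattern (b), promote request filed 2026-08-26).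
The mathematics is the published blow-up procedure at a local Type I singular point (Seregin–Šverák 2009, §2 and
Thm. 2.8; Albritton–Barker 2019, Prop. 2.4 and §3); nothing here is a claim about Navier–Stokes regularity.

Ninth helper file for the forward direction of Albritton–Barker 2019, Thm. 1.1.  In print
(Seregin–Šverák 2009, Thm. 2.8) the rescaled fields `u^k`, `|u^k| ≤ 1`, `|u^k(0,0)| = 1`, are
uniformly Hölder continuous near the vertex, so that their locally uniform limit keeps
`|u(0,0)| = 1` and is non-trivial.  We pass to the limit in `L³` only (file `…Engine`), and
non-triviality is secured here: by the tree's uniform local Hölder bound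
`SereginSverak2009.LocalHolderBound_holds` (the estimate of §4, (p12)ff, for solutions with
`|u| ≤ 1` and `∫_{Q(4)} |p|^{3/2} ≤ c`; the pressure bound comes from `D ≤ 𝐈` after the
unit-ball normalisation of file `…Normalization`), every term `v_k`, `k ≥ 3`, of the blow-up
sequence satisfies `‖v_k(w) − v_k(0)‖ ≤ K d(w, 0)^α` on the Seregin–Šverák cylinder `Q(1/2)` with
constants independent of `k`; since `‖v_k(0)‖ = 1/2`, `‖v_k‖ ≥ 1/4` on a fixed neighbourhood of
the vertex inside `Q(0, 1)`, whence a uniform lower bound for `‖v_k‖_{L³(Q(0,1))}`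
(`exists_eLpNorm_lower_bound`).

## References

* G. Seregin, V. Šverák, Comm. PDE 34 (2009) = arXiv:0804.1803, §2 Thm. 2.8, §4 (p12)ff.
* D. Albritton, T. Barker, J. Math. Fluid Mech. 21 (2019) = arXiv:1811.00502, §3.
-/

noncomputable section

open MeasureTheory Set Function Filter Topology TopologicalSpace Metric
open scoped NNReal ENNReal
open Literature.Analysis Literature.Analysis.FluidPDE Literature.Analysis.FluidPDE.SereginSverak2009

namespace Literature.Analysis.FluidPDE.LocalTypeIBlowup

/-- `‖x‖² = |x'|² + x₃²`, so `Q(R) ⊆ Q(0, S)` for the Seregin–Šverák cylinder `Q(R)` as soon as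
`2 R² ≤ S²`, `0 < S`. [folklore] -/
private theorem parCyl_subset_parabolicCylinder {R S : ℝ} (hS : 0 < S) (hRS : 2 * R ^ 2 ≤ S ^ 2) :
    parCyl 0 R ⊆ parabolicCylinder S (0 : ℝ × (EuclideanSpace ℝ (Fin 3))) := by
  intro z hz
  rw [mem_parCyl_zero] at hz
  obtain ⟨⟨hz1, hz2⟩, hz3, hz4⟩ := hz
  rw [mem_parabolicCylinder]
  simp only [Prod.fst_zero, Prod.snd_zero, zero_sub, dist_zero_right]
  have hc := cylRadius_nonneg z.2
  have hsq : ‖z.2‖ ^ 2 < S ^ 2 := by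
    rw [norm_sq_eq_cylRadius_sq_add]
    have h1 : cylRadius z.2 ^ 2 < R ^ 2 := by nlinarith
    have h2 : z.2 2 ^ 2 < R ^ 2 := by
      have := abs_lt.1 hz4
      nlinarith [sq_abs (z.2 2)]
    linarith
  exact ⟨⟨by nlinarith, hz2⟩, lt_of_pow_lt_pow_left₀ 2 hS.le hsq⟩

/-- The points `(-ε, 0)`, `0 < ε < R²`, belong to the Seregin–Šverák cylinder `Q(R)`, `R > 0`. [folklore] -/
private theorem neg_zero_mem_parCyl {R ε : ℝ} (hR : 0 < R) (hε : 0 < ε) (hεR : ε < R ^ 2) :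
    ((-ε : ℝ), (0 : (EuclideanSpace ℝ (Fin 3)))) ∈ parCyl 0 R := by
  rw [mem_parCyl_zero]
  refine ⟨⟨by linarith, by linarith⟩, ?_, ?_⟩
  · have : cylRadius (0 : (EuclideanSpace ℝ (Fin 3))) = 0 := by simp [cylRadius]
    simpa [this] using hR
  · simpa using hR

/-- **Uniform `L³` mass of the blow-up sequence near the vertex** (module docstring): there is
`m₀ > 0` with `‖v_k‖_{L³(Q(0,1))} ≥ m₀` for all `k ≥ 3`.  Hypotheses: the class Def. 2.1 and the
Type I bound `𝐈(Q(0, 2ᵐ)) ≤ I` on the balls `Q(0, 2ᵐ)`, `m ≤ k`, the pointwise bound `‖v_k‖ ≤ 1`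
on `Q(0, 2^{k+1})`, the normalisation `‖v_k(0,0)‖ = 1/2`, continuity at the vertex and on
`Q(0, 2^{k+1})`. [cite: SereginSverak2009, Thm 2.8 and §4 (p12)ff] -/
theorem exists_eLpNorm_lower_bound {v : ℕ → ℝ → (EuclideanSpace ℝ (Fin 3)) → (EuclideanSpace ℝ (Fin 3))} {q : ℕ → ℝ → (EuclideanSpace ℝ (Fin 3)) → ℝ}
    {Gz : ℕ → ℝ → (EuclideanSpace ℝ (Fin 3)) → (EuclideanSpace ℝ (Fin 3)) →L[ℝ] (EuclideanSpace ℝ (Fin 3))} {I : ℝ≥0∞} (hI : I < ⊤)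
    (hballs : ∀ m k : ℕ, m ≤ k → IsSuitableWeakSolutionInBall ((2 : ℝ) ^ m) 0 (v k) (q k))
    (hIs : ∀ m k : ℕ, m ≤ k →
      typeIBound (parabolicCylinder ((2 : ℝ) ^ m) (0 : ℝ × (EuclideanSpace ℝ (Fin 3)))) (v k) (q k) (Gz k) ≤ I)
    (hbd1 : ∀ k, ∀ w ∈ parabolicCylinder ((2 : ℝ) ^ (k + 1)) (0 : ℝ × (EuclideanSpace ℝ (Fin 3))), ‖v k w.1 w.2‖ ≤ 1)
    (hvtx : ∀ k, ‖v k 0 0‖ = 1 / 2)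
    (hcontAt : ∀ k, ContinuousAt (uncurry (v k)) 0)
    (hcontOn : ∀ k, ContinuousOn (uncurry (v k)) (parabolicCylinder ((2 : ℝ) ^ (k + 1)) (0 : ℝ × (EuclideanSpace ℝ (Fin 3))))) :
    ∃ m₀ : ℝ≥0∞, 0 < m₀ ∧ ∀ k, 3 ≤ k →
      m₀ ≤ eLpNorm (uncurry (v k)) 3 (volume.restrict (parabolicCylinder 1 (0 : ℝ × (EuclideanSpace ℝ (Fin 3))))) := by
  have hItop : I ≠ ⊤ := hI.ne
  -- ## the uniform Hölder constants
  set cE : ℝ≥0∞ := 2 * (1 + volume (ball (0 : (EuclideanSpace ℝ (Fin 3))) 8) * (volume (ball (0 : (EuclideanSpace ℝ (Fin 3))) 1))⁻¹) *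
    (ENNReal.ofReal 8 ^ 2 * I) with hcE
  have hcEtop : cE ≠ ⊤ := by
    rw [hcE, ← mul_assoc]
    exact ENNReal.mul_ne_top (pressureConst_lt_top 8).ne hItop
  set c : ℝ≥0 := cE.toNNReal with hc
  have hcc : (c : ℝ≥0∞) = cE := ENNReal.coe_toNNReal hcEtop
  obtain ⟨α, K, hα, hHB⟩ := LocalHolderBound_holds 1 one_pos c
  have hα' : (0 : ℝ) < α := hα
  -- ## the radius `δ₀` with `K δ₀^α ≤ 1/4` and the neighbourhood `P` of the vertex
  set b : ℝ := 1 / (4 * ((K : ℝ) + 1)) with hb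
  have hK0 : (0 : ℝ) ≤ K := K.2
  have hb0 : 0 < b := by rw [hb]; positivity
  set δ₀ : ℝ := b ^ (1 / (α : ℝ)) with hδ₀
  have hδ₀0 : 0 < δ₀ := Real.rpow_pos_of_pos hb0 _
  have hδ₀α : δ₀ ^ (α : ℝ) = b := by
    rw [hδ₀, ← Real.rpow_mul hb0.le, one_div_mul_cancel hα'.ne', Real.rpow_one]
  have hKb : (K : ℝ) * b ≤ 1 / 4 := by
    rw [hb, ← mul_div_assoc, mul_one, div_le_iff₀ (by positivity)]
    nlinarith
  set P : Set (ℝ × (EuclideanSpace ℝ (Fin 3))) := parCyl 0 (1 / 2) ∩ ball (0 : ℝ × (EuclideanSpace ℝ (Fin 3))) δ₀ with hP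
  have hPopen : IsOpen P := (isOpen_parCyl _ _).inter isOpen_ball
  have hPne : P.Nonempty := by
    set ε : ℝ := min (δ₀ / 2) (1 / 8) with hε
    have hε0 : 0 < ε := lt_min (by linarith) (by norm_num)
    have hε1 : ε ≤ δ₀ / 2 := min_le_left _ _
    have hε2 : ε ≤ 1 / 8 := min_le_right _ _
    refine ⟨((-ε : ℝ), (0 : (EuclideanSpace ℝ (Fin 3)))), neg_zero_mem_parCyl (by norm_num) hε0 (by nlinarith), ?_⟩
    rw [mem_ball, Prod.dist_eq]
    simp only [Prod.fst_zero, Prod.snd_zero, dist_zero_right, norm_neg, Real.norm_eq_abs,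
      abs_of_pos hε0, norm_zero]
    rw [max_eq_left hε0.le]
    linarith
  have hPpos : 0 < volume P := hPopen.measure_pos volume hPne
  have hPmeas : MeasurableSet P := hPopen.measurableSet
  have hP1 : P ⊆ parabolicCylinder 1 (0 : ℝ × (EuclideanSpace ℝ (Fin 3))) :=
    inter_subset_left.trans (parCyl_subset_parabolicCylinder one_pos (by norm_num))
  -- the lower bound
  set m₀ : ℝ≥0∞ := (ENNReal.ofReal (1 / 4) ^ (3 : ℝ) * volume P) ^ (1 / 3 : ℝ) with hm₀
  have hm₀pos : 0 < m₀ := by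
    refine ENNReal.rpow_pos (ENNReal.mul_pos ?_ hPpos.ne') ?_
    · exact (ENNReal.rpow_pos (ENNReal.ofReal_pos.2 (by norm_num)) ENNReal.ofReal_ne_top).ne'
    · exact ENNReal.mul_ne_top (ENNReal.rpow_ne_top_of_nonneg (by norm_num) ENNReal.ofReal_ne_top)
        (measure_mono hP1 |>.trans_lt (by
          exact lt_of_le_of_lt (measure_mono (parabolicCylinder_subset_Icc_prod_closedBall 0 1))
            (isCompact_Icc_prod_closedBall 0 1).measure_lt_top)).ne
  refine ⟨m₀, hm₀pos, fun k hk => ?_⟩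
  -- ## the data of `LocalHolderBound` for `(v k, qn k)` on `Q(4) ⊆ Q(0, 8)`
  have h8 : (2 : ℝ) ^ 3 = 8 := by norm_num
  have hIn8 : IsSuitableWeakSolutionInBall 8 0 (v k) (q k) := h8 ▸ hballs 3 k hk
  have hI8 : typeIBound (parabolicCylinder 8 (0 : ℝ × (EuclideanSpace ℝ (Fin 3)))) (v k) (q k) (Gz k) ≤ I := h8 ▸ hIs 3 k hk
  set qn : ℝ → (EuclideanSpace ℝ (Fin 3)) → ℝ := fun t x => q k t x - ⨍ y in ball (0 : (EuclideanSpace ℝ (Fin 3))) 1, q k t y with hqn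
  have hIn8n : IsSuitableWeakSolutionInBall 8 0 (v k) qn :=
    isSuitableWeakSolutionInBall_sub_unitBallMean (by norm_num) hIn8
  have h0 : ∀ t, ⨍ y in ball (0 : (EuclideanSpace ℝ (Fin 3))) 1, qn t y = 0 := fun t => unitBallMean_normalised (q k) t
  have hsub4 : parCyl 0 (4 * 1) ⊆ parabolicCylinder 8 (0 : ℝ × (EuclideanSpace ℝ (Fin 3))) :=
    parCyl_subset_parabolicCylinder (by norm_num) (by norm_num)
  have hsub4k : parabolicCylinder 8 (0 : ℝ × (EuclideanSpace ℝ (Fin 3))) ⊆ parabolicCylinder ((2 : ℝ) ^ (k + 1)) (0 : ℝ × (EuclideanSpace ℝ (Fin 3))) :=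
    parabolicCylinder_mono (by norm_num) (by
      calc (8 : ℝ) = 2 ^ 3 := by norm_num
        _ ≤ 2 ^ (k + 1) := pow_le_pow_right₀ (by norm_num) (by omega)) _
  have hdist : IsDistributionalNSSolutionOn (parCylOpens 0 (4 * 1)) 1 0 (v k) qn :=
    hIn8n.1.distributional.of_le fun w hw => hsub4 hw
  have haeb : ∀ᵐ z ∂(volume.restrict (parCyl 0 (4 * 1))), ‖v k z.1 z.2‖ ≤ 1 := by
    filter_upwards [ae_restrict_mem (isOpen_parCyl _ _).measurableSet] with z hz
    exact hbd1 k z (hsub4k (hsub4 hz))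
  have hpress : ∫⁻ z in parCyl 0 (4 * 1), ‖qn z.1 z.2‖ₑ ^ (3 / 2 : ℝ) ≤ c := by
    rw [hcc, hcE]
    refine (lintegral_mono_set hsub4).trans ((lintegral_pressure_ball_le (by norm_num)
      hIn8n.2.2.2.1 h0).trans ?_)
    gcongr
    calc cknDOsc 8 0 qn ≤ typeIBound (parabolicCylinder 8 (0 : ℝ × (EuclideanSpace ℝ (Fin 3)))) (v k) qn (Gz k) :=
          (cknDOsc_le_abScaledSum (u := v k) (G := Gz k)).trans
            (abScaledSum_le_typeIBound (by norm_num) Subset.rfl)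
      _ = typeIBound (parabolicCylinder 8 (0 : ℝ × (EuclideanSpace ℝ (Fin 3)))) (v k) (q k) (Gz k) :=
          typeIBound_sub_unitBallMean_ball hIn8.2.2.2
      _ ≤ I := hI8
  obtain ⟨V, hVae, hVH⟩ := hHB (v k) qn hdist haeb hpress
  -- ## `V = v k` on `Q(1/2)`
  have hhalf : parCyl 0 (1 / 2) ⊆ parabolicCylinder ((2 : ℝ) ^ (k + 1)) (0 : ℝ × (EuclideanSpace ℝ (Fin 3))) :=
    (parCyl_subset_parabolicCylinder one_pos (by norm_num)).trans
      ((parabolicCylinder_mono zero_le_one (by norm_num) _).trans hsub4k)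
  have hEq : EqOn V (uncurry (v k)) (parCyl 0 (1 / 2)) :=
    Measure.eqOn_open_of_ae_eq hVae (isOpen_parCyl _ _) (hVH.continuousOn hα)
      ((hcontOn k).mono hhalf)
  -- ## Hölder estimate up to the vertex
  have hvert : ∀ w ∈ parCyl 0 (1 / 2),
      dist (uncurry (v k) w) (uncurry (v k) 0) ≤ K * dist w 0 ^ (α : ℝ) := by
    intro w hw
    -- the points `(-1/(8(n+1)), 0) → 0` inside `Q(1/2)`
    set pts : ℕ → ℝ × (EuclideanSpace ℝ (Fin 3)) := fun n => ((-(1 / (8 * ((n : ℝ) + 1))) : ℝ), (0 : (EuclideanSpace ℝ (Fin 3)))) with hpts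
    have hpts_mem : ∀ n, pts n ∈ parCyl 0 (1 / 2) := fun n => by
      refine neg_zero_mem_parCyl (by norm_num) (by positivity) ?_
      have : (1 : ℝ) / (8 * ((n : ℝ) + 1)) ≤ 1 / 8 :=
        div_le_div_of_nonneg_left zero_le_one (by norm_num) (by linarith [n.cast_nonneg (α := ℝ)])
      linarith
    have hpts_lim : Tendsto pts atTop (𝓝 0) := by
      rw [show (0 : ℝ × (EuclideanSpace ℝ (Fin 3))) = ((0 : ℝ), (0 : (EuclideanSpace ℝ (Fin 3)))) from rfl]
      refine Tendsto.prodMk_nhds ?_ tendsto_const_nhds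
      have h1 : Tendsto (fun n : ℕ => (1 : ℝ) / (8 * ((n : ℝ) + 1))) atTop (𝓝 0) := by
        have h2 : Tendsto (fun n : ℕ => 8 * ((n : ℝ) + 1)) atTop atTop :=
          Tendsto.const_mul_atTop (by norm_num) (tendsto_natCast_atTop_atTop.atTop_add tendsto_const_nhds)
        exact tendsto_const_nhds.div_atTop h2
      simpa using h1.neg
    have hineq : ∀ n, dist (uncurry (v k) w) (uncurry (v k) (pts n)) ≤ K * dist w (pts n) ^ (α : ℝ) := by
      intro n
      have h := hVH.dist_le hw (hpts_mem n)
      rwa [hEq hw, hEq (hpts_mem n)] at h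
    have hL : Tendsto (fun n => dist (uncurry (v k) w) (uncurry (v k) (pts n))) atTop
        (𝓝 (dist (uncurry (v k) w) (uncurry (v k) 0))) :=
      tendsto_const_nhds.dist ((hcontAt k).tendsto.comp hpts_lim)
    have hR : Tendsto (fun n => (K : ℝ) * dist w (pts n) ^ (α : ℝ)) atTop
        (𝓝 ((K : ℝ) * dist w 0 ^ (α : ℝ))) :=
      ((tendsto_const_nhds.dist hpts_lim).rpow_const (Or.inr hα'.le)).const_mul _
    exact le_of_tendsto_of_tendsto hL hR (Eventually.of_forall hineq)
  -- ## `‖v k‖ ≥ 1/4` on `P`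
  have hquarter : ∀ w ∈ P, (1 / 4 : ℝ) ≤ ‖uncurry (v k) w‖ := by
    rintro w ⟨hw1, hw2⟩
    rw [mem_ball] at hw2
    have h1 := hvert w hw1
    have h2 : dist w 0 ^ (α : ℝ) ≤ δ₀ ^ (α : ℝ) :=
      Real.rpow_le_rpow dist_nonneg hw2.le hα'.le
    have h3 : (K : ℝ) * dist w 0 ^ (α : ℝ) ≤ 1 / 4 := by
      calc (K : ℝ) * dist w 0 ^ (α : ℝ) ≤ K * δ₀ ^ (α : ℝ) := mul_le_mul_of_nonneg_left h2 hK0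
        _ = K * b := by rw [hδ₀α]
        _ ≤ 1 / 4 := hKb
    have h4 : ‖uncurry (v k) 0‖ = 1 / 2 := hvtx k
    have h5 := norm_sub_norm_le (uncurry (v k) 0) (uncurry (v k) w)
    rw [← dist_eq_norm, dist_comm] at h5
    linarith
  -- ## the `L³` lower bound
  have hpt : ∀ w ∈ P, ENNReal.ofReal (1 / 4) ^ (3 : ℝ) ≤ ‖uncurry (v k) w‖ₑ ^ (3 : ℝ) := by
    intro w hw
    refine ENNReal.rpow_le_rpow ?_ (by norm_num)
    rw [← ofReal_norm]
    exact ENNReal.ofReal_le_ofReal (hquarter w hw)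
  rw [eLpNorm_eq_lintegral_rpow_enorm_toReal (by norm_num) (by norm_num), ENNReal.toReal_ofNat, hm₀]
  refine ENNReal.rpow_le_rpow ?_ (by norm_num)
  calc ENNReal.ofReal (1 / 4) ^ (3 : ℝ) * volume P
      = ∫⁻ _ in P, ENNReal.ofReal (1 / 4) ^ (3 : ℝ) := by rw [setLIntegral_const]
    _ ≤ ∫⁻ w in P, ‖uncurry (v k) w‖ₑ ^ (3 : ℝ) :=
        setLIntegral_mono' hPmeas fun w hw => hpt w hw
    _ ≤ ∫⁻ w in parabolicCylinder 1 (0 : ℝ × (EuclideanSpace ℝ (Fin 3))), ‖uncurry (v k) w‖ₑ ^ (3 : ℝ) :=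
        lintegral_mono_set hP1

end Literature.Analysis.FluidPDE.LocalTypeIBlowup

end
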